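import Mathlib

/-!
# (A11) of the N5 [A]-ledger in kernel form: `ω̃(π_E)² = η_v(−1)` at a tame ramified place

Kernel witnesses (Mathlib only) for the computation behind item (A11) of route/T5-route-2.md
§N5.12.6 («at a tame ramified `v`: `ω̃² ≠ 1` when `η_v(−1) = −1` — computed in N5.12.2:
`ω̃(π_E)² = η_v(−1)` for `π_E` with `π̄_E = −π_E`»), the one item of the ledger whose content is a
two-line algebraic identity once the objects are taken as what they are:

* `E/F` fields with an `F`-algebra involution `σ` whose fixed points are exactly `F`
  (for a quadratic Galois extension this is `T5QuadraticInvolution.mem_range_algebraMap_of_fixed_of_quadratic`);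
* `ξ : Eˣ →* M` a character whose restriction to `Fˣ` is `η : Fˣ →* M`
  («`ω̃` conjugate-symplectic: `ω̃|_{F_v^×} = η_v`»), with `η` trivial on the norms `x σ(x)`
  («`η_v` is the quadratic character attached to `E_v/F_v`: trivial on `N(E_v^×)`»);
* `π ∈ Eˣ` with `σ π = -π` («`π̄_E = −π_E`»).

Then `π² = −(π σ(π)) = −N(π)` and `ξ(π)² = ξ(π²) = η(−N(π)) = η(−1) η(N(π)) = η(−1)`
(`sq_apply_eq_apply_neg_one`); hence `ξ² ≠ 1` as soon as `η(−1) ≠ 1` (`sq_ne_one_of_apply_neg_one_ne_one`,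
`sq_ne_one_of_apply_neg_one_eq_neg_one` for `ℂˣ`-valued characters). The existence of such a `π`:
every `δ ∉ F` with `δ² ∈ F` satisfies `σ δ = −δ` (`apply_eq_neg_of_sq_mem`) — for
`E_v = F_v(√(π_F u))`, `δ = √(π_F u)`; and `v(δ) = exp(−1)` when `v(δ²) = exp(−2)`
(`val_eq_exp_neg_one_of_sq`: `δ` is a uniformiser).

What stays prose: that `η_v` is trivial on norms and that `E_v = F_v(√(π_F u))` at a tame ramified
place (local class field theory / the structure of tamely ramified quadratic extensions);
`N(π_E) = −π_F u` and `η_v(π_F u) = η_v(−1)` are the instances of the identities above.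

Uses an L-value-free non-vanishing device: NO (README §8(d)).
-/

namespace Summit.Ventures.HodgeRepro2.T5TameRamifiedSquare

open WithZero

section Involution

variable {F E : Type*} [Field F] [Field E] [Algebra F E] (σ : E ≃ₐ[F] E)

/-- `π² = −(π σ(π))` when `σ π = -π`: the square of an anti-invariant element is minus its norm. -/
theorem sq_eq_neg_mul_apply {π : E} (hπ : σ π = -π) : π ^ 2 = -(π * σ π) := by
  rw [hπ]; ring

/-- The norm `x σ(x)` is `σ`-fixed when `σ` is an involution. -/
theorem apply_mul_apply (hσ : ∀ x, σ (σ x) = x) (x : E) : σ (x * σ x) = x * σ x := by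
  rw [map_mul, hσ, mul_comm]

/-- With fixed points `F`, the norm `x σ(x)` lies in `F`. -/
theorem mul_apply_mem_range (hσ : ∀ x, σ (σ x) = x)
    (hfix : ∀ x, σ x = x → x ∈ (algebraMap F E).range) (x : E) :
    x * σ x ∈ (algebraMap F E).range :=
  hfix _ (apply_mul_apply σ hσ x)

/-- Every `δ ∉ F` with `δ² ∈ F` is anti-invariant: `σ δ = -δ` («`σ(√a) = −√a`»). -/
theorem apply_eq_neg_of_sq_mem (hfix : ∀ x, σ x = x → x ∈ (algebraMap F E).range) {δ : E}
    (h2 : δ ^ 2 ∈ (algebraMap F E).range) (hδ : δ ∉ (algebraMap F E).range) : σ δ = -δ := by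
  obtain ⟨a, ha⟩ := h2
  have hsq : (σ δ) ^ 2 = δ ^ 2 := by
    rw [← map_pow, ← ha, AlgEquiv.commutes]
  rcases sq_eq_sq_iff_eq_or_eq_neg.1 hsq with h | h
  · exact absurd (hfix δ h) hδ
  · exact h

end Involution

section Character

variable {F E : Type*} [Field F] [Field E] [Algebra F E] (σ : E ≃ₐ[F] E)
variable {M : Type*} [CommGroup M]

/-- The norm of a unit as a unit of `F` (with fixed points `F`): `π σ(π) = algebraMap F E (normUnit π)`. -/
theorem exists_units_algebraMap_eq_mul_apply (hσ : ∀ x, σ (σ x) = x)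
    (hfix : ∀ x, σ x = x → x ∈ (algebraMap F E).range) (π : Eˣ) :
    ∃ f : Fˣ, algebraMap F E (f : F) = (π : E) * σ π := by
  obtain ⟨f, hf⟩ := mul_apply_mem_range σ hσ hfix (π : E)
  have hf0 : f ≠ 0 := by
    rintro rfl
    rw [map_zero] at hf
    exact mul_ne_zero π.ne_zero ((map_ne_zero σ).2 π.ne_zero) hf.symm
  exact ⟨Units.mk0 f hf0, by rw [Units.val_mk0]; exact hf⟩

/-- The computation of (A11): `ξ(π)² = η(−1)` for `π` anti-invariant, `ξ|_{Fˣ} = η` and `η` trivial on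
norms («`ω̃(π_E)² = η_v(−1)`»). -/
theorem sq_apply_eq_apply_neg_one (hσ : ∀ x, σ (σ x) = x)
    (hfix : ∀ x, σ x = x → x ∈ (algebraMap F E).range) (ξ : Eˣ →* M) (η : Fˣ →* M)
    (hξη : ∀ f : Fˣ, ξ (Units.map (algebraMap F E : F →* E) f) = η f)
    (hη : ∀ (x : Eˣ) (f : Fˣ), algebraMap F E (f : F) = (x : E) * σ x → η f = 1)
    {π : Eˣ} (hπ : σ π = -(π : E)) : ξ π ^ 2 = η (-1) := by
  obtain ⟨f, hf⟩ := exists_units_algebraMap_eq_mul_apply σ hσ hfix π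
  have hsq : π ^ 2 = Units.map (algebraMap F E : F →* E) (-1 * f) := by
    apply Units.ext
    rw [Units.val_pow_eq_pow_val, Units.coe_map, Units.val_mul, Units.val_neg, Units.val_one,
      MonoidHom.coe_coe, map_mul, map_neg, map_one, hf, sq_eq_neg_mul_apply σ hπ, neg_one_mul]
  rw [← map_pow, hsq, hξη, map_mul, hη π f hf, mul_one]

/-- (A11): `ξ² ≠ 1` as soon as `η(−1) ≠ 1` (a `π` with `σ π = -π` exists). -/
theorem sq_ne_one_of_apply_neg_one_ne_one (hσ : ∀ x, σ (σ x) = x)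
    (hfix : ∀ x, σ x = x → x ∈ (algebraMap F E).range) (ξ : Eˣ →* M) (η : Fˣ →* M)
    (hξη : ∀ f : Fˣ, ξ (Units.map (algebraMap F E : F →* E) f) = η f)
    (hη : ∀ (x : Eˣ) (f : Fˣ), algebraMap F E (f : F) = (x : E) * σ x → η f = 1)
    {π : Eˣ} (hπ : σ π = -(π : E)) (h1 : η (-1) ≠ 1) : ξ ^ 2 ≠ 1 := by
  intro h
  apply h1
  rw [← sq_apply_eq_apply_neg_one σ hσ hfix ξ η hξη hη hπ, ← MonoidHom.pow_apply, h,
    MonoidHom.one_apply]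

/-- (A11) for `ℂˣ`-valued characters, as worded: `ω̃² ≠ 1` when `η_v(−1) = −1`. -/
theorem sq_ne_one_of_apply_neg_one_eq_neg_one (hσ : ∀ x, σ (σ x) = x)
    (hfix : ∀ x, σ x = x → x ∈ (algebraMap F E).range) (ξ : Eˣ →* ℂˣ) (η : Fˣ →* ℂˣ)
    (hξη : ∀ f : Fˣ, ξ (Units.map (algebraMap F E : F →* E) f) = η f)
    (hη : ∀ (x : Eˣ) (f : Fˣ), algebraMap F E (f : F) = (x : E) * σ x → η f = 1)
    {π : Eˣ} (hπ : σ π = -(π : E)) (h1 : η (-1) = -1) : ξ ^ 2 ≠ 1 := by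
  refine sq_ne_one_of_apply_neg_one_ne_one σ hσ hfix ξ η hξη hη hπ ?_
  rw [h1]
  intro h
  have h' : ((-1 : ℂˣ) : ℂ) = ((1 : ℂˣ) : ℂ) := congrArg Units.val h
  rw [Units.val_neg, Units.val_one] at h'
  exact absurd h' (by norm_num)

end Character

section Uniformiser

variable {E : Type*} [Field E]

/-- If `v(δ²) = exp(−2)` then `v(δ) = exp(−1)`: a square root of an element of valuation `exp(−2)`
is a uniformiser («`v_E(√(π_F u)) = 1`» at a ramified place, `e = 2`). -/
theorem val_eq_exp_neg_one_of_sq (v : Valuation E ℤᵐ⁰) {δ : E} (h : v (δ ^ 2) = exp (-2)) :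
    v δ = exp (-1) := by
  have hne : v δ ≠ 0 := by
    intro h0
    rw [Valuation.map_pow, h0, zero_pow two_ne_zero] at h
    exact exp_ne_zero h.symm
  have hlog : exp (2 • log (v δ)) = exp (-2) := by
    rw [exp_nsmul, exp_log hne, ← Valuation.map_pow, h]
  rw [exp_inj] at hlog
  have h2 : (2 : ℤ) * log (v δ) = -2 := by simpa [nsmul_eq_mul] using hlog
  rw [← exp_log hne]
  congr 1
  omega

end Uniformiser

end Summit.Ventures.HodgeRepro2.T5TameRamifiedSquare
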